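import Mathlib
import Literature.NumberTheory.Transcendental.KZCalculusProofs
import Literature.NumberTheory.Transcendental.KZLogCalculusProofs
import Literature.NumberTheory.Transcendental.KZSemiCanonicalReductionProofs
import Literature.NumberTheory.Transcendental.KZSubcalculusInvariants
import Literature.NumberTheory.Transcendental.KZIntervalPeriodProofs
import Literature.NumberTheory.Transcendental.KZIdealTetrahedron
import Literature.NumberTheory.Transcendental.BoxCoordinatePowerMap

/-!
# `OffTetraSectorKernel`, line `odd-hyperbolic-ladder`: the odd/even splitting of `ζ(2)` inside the calculus (stub `stub_zetaBoxOddEven`)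

Stub `stub_zetaBoxOddEven` of the crux `OffTetraSectorKernel` (stmt-KontsevichZagierPeriods-10557,
route HyperbolicBloch). On the open unit box `□ = (0,1)²` the two Kontsevich–Zagier representations
`Z = [□, 1/(1 − xy)]` (value `ζ(2)`) and `Z' = [□, 1/(1 − x²y²)]` (value `(3/4) ζ(2)`, the odd part
of `Σ 1/n²`) satisfy `3·[Z] ≡ 4·[Z']` modulo the moves of the calculus. This is Kontsevich–Zagier's
own un-derived step "`Σ 1/n² = Σ_odd + ¼ Σ 1/n²`" of §1.2, realised by three explicit moves:

* rule (1b), integrand additivity: pointwise on `□`, `1/(1 − xy) = 1/(1 − x²y²) + xy/(1 − x²y²)`,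
  so `[Z] − [Z'] − [M] ∈ integrandAddRel` with `M = [□, xy/(1 − x²y²)]` (which exists: rational
  integrand, dominated by `1/(1 − xy)`);
* rule (2), change of variables: the squaring map `Φ(x, y) = (x², y²)` is a bijection of `□` with
  Jacobian `4xy` (`BoxIntegral.coordPow 2`), and `4xy/(1 − x²y²) = [1/(1 − uv)]∘Φ · |det Φ'|`, so
  `[□, 4·xy/(1 − x²y²)] − [Z] ∈ changeOfVariablesRel`;
* rule (1b) again, integer scaling: `[□, 4 f] − 4·[□, f] ∈ relations`
  (`KZ.IntegralRep.of_constMul_nat_sub_nsmul_mem_relations`);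

and the bookkeeping `3[Z] − 4[Z'] = 4([Z] − [Z'] − [M]) − ([4M] − 4[M]) + ([4M] − [Z])`.

References: M. Kontsevich, D. Zagier, *Periods* (2001), §1.2 (p. 9); J. Bochnak, M. Coste,
M.-F. Roy, *Real Algebraic Geometry* (1998), §2.2.
-/

noncomputable section

open Set MeasureTheory MvPolynomial
open Literature.NumberTheory.Transcendental Literature.ModelTheory.ExponentialFields

namespace Summit.KontsevichZagierPeriods.HyperbolicBloch.OffTetraSectorKernel

/-! ### Pointwise facts on the open unit box -/

/-- On the open unit box `(0,1)²` the product `x₀ x₁` lies in `(0, 1)`. [folklore] -/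
theorem zetaBox_mul_mem {x : Fin 2 → ℝ} (hx : ∀ i, x i ∈ Ioo (0 : ℝ) 1) :
    0 < x 0 * x 1 ∧ x 0 * x 1 < 1 :=
  ⟨mul_pos (hx 0).1 (hx 1).1, mul_lt_one_of_nonneg_of_lt_one_left (hx 0).1.le (hx 0).2 (hx 1).2.le⟩

/-- On the open unit box the two denominators `1 − x₀x₁` and `1 − x₀²x₁²` are positive. [folklore] -/
theorem zetaBox_denom_pos {x : Fin 2 → ℝ} (hx : ∀ i, x i ∈ Ioo (0 : ℝ) 1) :
    0 < 1 - x 0 * x 1 ∧ 0 < 1 - x 0 ^ 2 * x 1 ^ 2 := by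
  obtain ⟨h0, h1⟩ := zetaBox_mul_mem hx
  refine ⟨by linarith, ?_⟩
  rw [← mul_pow]
  nlinarith

/-- **The odd/even splitting, pointwise**: `1/(1 − t) = 1/(1 − t²) + t/(1 − t²)` for `t = x₀x₁` on
the open unit box (`1 − t² = (1 − t)(1 + t)`). [cite: KontsevichZagier2001, §1.2] -/
theorem zetaBox_split {x : Fin 2 → ℝ} (hx : ∀ i, x i ∈ Ioo (0 : ℝ) 1) :
    1 / (1 - x 0 * x 1) = 1 / (1 - x 0 ^ 2 * x 1 ^ 2) + x 0 * x 1 / (1 - x 0 ^ 2 * x 1 ^ 2) := by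
  obtain ⟨h0, h1⟩ := zetaBox_denom_pos hx
  have h0' : 1 - x 0 * x 1 ≠ 0 := h0.ne'
  have h1' : 1 - x 0 ^ 2 * x 1 ^ 2 ≠ 0 := h1.ne'
  field_simp
  ring

/-- The mixed term is dominated by the full kernel on the box:
`0 ≤ x₀x₁/(1 − x₀²x₁²) ≤ 1/(1 − x₀x₁)`. [folklore] -/
theorem zetaBox_mixed_le {x : Fin 2 → ℝ} (hx : ∀ i, x i ∈ Ioo (0 : ℝ) 1) :
    0 ≤ x 0 * x 1 / (1 - x 0 ^ 2 * x 1 ^ 2) ∧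
      x 0 * x 1 / (1 - x 0 ^ 2 * x 1 ^ 2) ≤ 1 / (1 - x 0 * x 1) := by
  obtain ⟨h0, h1⟩ := zetaBox_denom_pos hx
  obtain ⟨hm0, -⟩ := zetaBox_mul_mem hx
  refine ⟨div_nonneg hm0.le h1.le, ?_⟩
  rw [zetaBox_split hx]
  have : 0 ≤ 1 / (1 - x 0 ^ 2 * x 1 ^ 2) := div_nonneg zero_le_one h1.le
  linarith

/-! ### The mixed representation `M = [□, x₀x₁/(1 − x₀²x₁²)]` -/

/-- **The mixed representation exists.** On the open unit box the function `x₀x₁/(1 − x₀²x₁²)` is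
a quotient of rational polynomials with non-vanishing denominator (hence `ℚ`-semialgebraic) and is
integrable, being measurable and dominated by the integrable kernel `1/(1 − x₀x₁)` of `Z`.
[cite: KontsevichZagier2001, §1.1] -/
theorem zetaBox_exists_mixed (Z : KZ.IntegralRep 2) (hZ : Z.domain = {x | ∀ i, x i ∈ Ioo (0 : ℝ) 1})
    (hZi : EqOn Z.integrand (fun x => 1 / (1 - x 0 * x 1)) Z.domain) :
    ∃ M : KZ.IntegralRep 2, M.domain = {x | ∀ i, x i ∈ Ioo (0 : ℝ) 1} ∧
      M.integrand = fun x => x 0 * x 1 / (1 - x 0 ^ 2 * x 1 ^ 2) := by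
  have hσ : IsSemialgebraic ℚ {x : Fin 2 → ℝ | ∀ i, x i ∈ Ioo (0 : ℝ) 1} :=
    hZ ▸ Z.isSemialgebraic_domain
  have hmeas : MeasurableSet {x : Fin 2 → ℝ | ∀ i, x i ∈ Ioo (0 : ℝ) 1} :=
    BoxIntegral.measurableSet_box 2
  -- semialgebraicity: a quotient of rational polynomials
  have hq : ∀ x ∈ {x : Fin 2 → ℝ | ∀ i, x i ∈ Ioo (0 : ℝ) 1},
      aeval x (1 - X 0 ^ 2 * X 1 ^ 2 : MvPolynomial (Fin 2) ℚ) ≠ 0 := fun x hx => by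
    simpa using (zetaBox_denom_pos hx).2.ne'
  have hsa : IsSemialgebraicFunOn ℚ {x : Fin 2 → ℝ | ∀ i, x i ∈ Ioo (0 : ℝ) 1}
      (fun x => x 0 * x 1 / (1 - x 0 ^ 2 * x 1 ^ 2)) :=
    (isSemialgebraicFunOn_aeval_div_aeval hσ (X 0 * X 1) (1 - X 0 ^ 2 * X 1 ^ 2) hq).congr
      fun x _ => by simp
  -- integrability: dominated by the kernel of `Z`
  have hint : IntegrableOn (fun x : Fin 2 → ℝ => x 0 * x 1 / (1 - x 0 ^ 2 * x 1 ^ 2))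
      {x : Fin 2 → ℝ | ∀ i, x i ∈ Ioo (0 : ℝ) 1} := by
    have hZint : IntegrableOn Z.integrand {x : Fin 2 → ℝ | ∀ i, x i ∈ Ioo (0 : ℝ) 1} :=
      hZ ▸ Z.integrableOn
    refine Integrable.mono' hZint (KZ.aestronglyMeasurable_of_isSemialgebraicFunOn hsa hmeas)
      ((ae_restrict_mem hmeas).mono fun x hx => ?_)
    obtain ⟨h0, h1⟩ := zetaBox_mixed_le hx
    rw [Real.norm_eq_abs, abs_of_nonneg h0, hZi (by rw [hZ]; exact hx)]
    exact h1
  exact ⟨⟨_, _, hσ, hsa, hint⟩, rfl, rfl⟩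

/-! ### The stub -/

/-- **STUB `stub_zetaBoxOddEven`: the odd/even splitting of `Σ 1/n²` inside the calculus**,
`3·[(0,1)², 1/(1−xy)] ≡ 4·[(0,1)², 1/(1−x²y²)]`: integrand additivity
`1/(1−xy) = 1/(1−x²y²) + xy/(1−x²y²)` (rule (1b)), the squaring map `(x,y) ↦ (x²,y²)` of the open
box onto itself (Jacobian `4xy`; rule (2)), which turns `[(0,1)², 4·xy/(1−x²y²)]` into
`[(0,1)², 1/(1−uv)]`, and integer bookkeeping by additivity (`[σ, 4f] ≡ 4·[σ, f]`).
[cite: KontsevichZagier2001, §1.2] -/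
theorem stub_zetaBoxOddEven :
    ∀ (Z Z' : KZ.IntegralRep 2), Z.domain = {x | ∀ i, x i ∈ Set.Ioo (0:ℝ) 1} →
      Set.EqOn Z.integrand (fun x => 1 / (1 - x 0 * x 1)) Z.domain →
      Z'.domain = {x | ∀ i, x i ∈ Set.Ioo (0:ℝ) 1} →
      Set.EqOn Z'.integrand (fun x => 1 / (1 - ∏ i, x i ^ 2)) Z'.domain →
      3 • KZ.of Z - 4 • KZ.of Z' ∈ KZ.relations := by
  intro Z Z' hZ hZi hZ' hZ'i
  obtain ⟨M, hMd, hMi⟩ := zetaBox_exists_mixed Z hZ hZi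
  have hσ : IsSemialgebraic ℚ {x : Fin 2 → ℝ | ∀ i, x i ∈ Ioo (0 : ℝ) 1} :=
    hZ ▸ Z.isSemialgebraic_domain
  -- rule (1b): `[Z] − [Z'] − [M]`
  have h1b : KZ.of Z - KZ.of Z' - KZ.of M ∈ KZ.relations := by
    refine KZ.integrandAddRel_subset_relations ⟨2, Z, Z', M, by rw [hZ, hZ'], by rw [hMd, hZ],
      fun x hx => ?_, rfl⟩
    have hxB : ∀ i, x i ∈ Ioo (0 : ℝ) 1 := by rw [hZ] at hx; exact hx
    rw [Pi.add_apply, hZi hx, hZ'i (by rw [hZ']; exact hxB), hMi]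
    simp only [Fin.prod_univ_two]
    exact zetaBox_split hxB
  -- the scaled mixed representation `[□, 4·xy/(1 − x²y²)]`
  set M4 : KZ.IntegralRep 2 := M.constMul ((4 : ℕ) : ℝ) (isAlgebraic_nat 4) with hM4
  have hM4d : M4.domain = {x | ∀ i, x i ∈ Ioo (0 : ℝ) 1} := by
    rw [hM4, KZ.IntegralRep.domain_constMul, hMd]
  -- rule (1b), integer scaling: `[4M] − 4[M]`
  have hscale : KZ.of M4 - 4 • KZ.of M ∈ KZ.relations :=
    KZ.IntegralRep.of_constMul_nat_sub_nsmul_mem_relations M 4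
  -- rule (2): the squaring map carries `[4M]` to `[Z]`
  have hcov : KZ.of M4 - KZ.of Z ∈ KZ.relations := by
    refine KZ.changeOfVariablesRel_subset_relations
      ⟨2, M4, Z, BoxIntegral.coordPow 2, BoxIntegral.coordPowDeriv 2, ?_,
        fun x _ => BoxIntegral.hasFDerivWithinAt_coordPow 2 _ x, ?_, ?_, ?_, rfl⟩
    · -- the squaring map is polynomial, hence `ℚ`-semialgebraic
      rw [hM4d]
      refine (isSemialgebraicMapOn_aeval hσ
        (fun j => (X j : MvPolynomial (Fin 2) ℚ) ^ 2)).congr fun x _ => ?_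
      funext j
      simp [BoxIntegral.coordPow]
    · rw [hM4d]
      exact BoxIntegral.injOn_coordPow_box two_ne_zero
    · rw [hM4d, hZ]
      exact (BoxIntegral.image_coordPow_box two_ne_zero).symm
    · intro x hx
      rw [hM4d] at hx
      have hΦx : BoxIntegral.coordPow 2 x ∈ Z.domain := by
        rw [hZ]
        exact BoxIntegral.mapsTo_coordPow_box two_ne_zero hx
      rw [BoxIntegral.abs_det_coordPowDeriv two_ne_zero hx, hZi hΦx, hM4,
        KZ.IntegralRep.integrand_constMul, hMi]
      have h1 := (zetaBox_denom_pos hx).2.ne'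
      simp only [BoxIntegral.coordPow_apply, Fin.prod_univ_two, Nat.cast_ofNat]
      field_simp
      ring
  -- bookkeeping
  have hsum : 3 • KZ.of Z - 4 • KZ.of Z' =
      4 • (KZ.of Z - KZ.of Z' - KZ.of M) - (KZ.of M4 - 4 • KZ.of M) + (KZ.of M4 - KZ.of Z) := by
    abel
  rw [hsum]
  exact KZ.relations.add_mem (KZ.relations.sub_mem (KZ.relations.nsmul_mem h1b 4) hscale) hcov

end Summit.KontsevichZagierPeriods.HyperbolicBloch.OffTetraSectorKernel

end
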